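import Summits.AtomisticToContinuum.FouriersLaw.Theses.BondHeatUncertainty
import Literature.MathematicalPhysics.KineticTheory.LangevinChainEnergyIdentity

/-!
# `SubdiffusiveBondHeat` / bath-bond reduction, part 2: the pathwise energy balance at the bath site

Helper file for crux `stmt-AtomisticToContinuum-9120` (`BondHeatUncertainty.SubdiffusiveBondHeat`), line
`bath-bond-deficit-integral`, stub `stub_bathBondReduction`. The Kundu–Dhar–Narayan reduction of the
bath-bond heat `∫₀ᵗ j₀` to the left-bath heat `Q^L_t` is the energy balance at site `0`,
`∫₀ᵗ j₀ = Q^L_t - Δe₀` with `e₀ = p₀²/2 + U(q₀) + ½V(q₁ - q₀)` and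
`dQ^L = γ(T_L - p₀²) dt + √(2γT_L) p₀ dW`. This file proves it PATH BY PATH for the flow
`z = chainFlow x η` of the pinned chain (`LangevinChainSDE.lean`: `z(t) = x + (0, η(t)) + ∫₀ᵗ Y(z(s)) ds`)
driven by an arbitrary continuous momentum-noise path `η` — the site-`0` analogue of the whole-chain
energy identity `pinnedChain_hamiltonian_chainFlow_eq` (`LangevinChainEnergyIdentity.lean`):

  `e₀(z(t)) = e₀(x) - ∫₀ᵗ j₀(z(s)) ds - γ ∫₀ᵗ p₀(s)² ds + 𝓜⁰_t`,
  `𝓜⁰_t = A₀(t) η₀(t) - ∫₀ᵗ η₀(s) A₀'(s) ds + η₀(t)²/2`,  `A₀ = p₀ - η₀`, `A₀' = Y(z)_{p,0}`,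

where `𝓜⁰_t` is the `i = 0` summand of the pathwise noise work `OscillatorChain.noiseWork` (formally
`∫ p₀ dη₀` integrated by parts; for the Brownian noise `η₀ = √(2γT_L) B` it is the Itô integral
`√(2γT_L) ∫₀ᵗ p₀ dB` plus its compensator `γ T_L t`), so that `Q^L_t = 𝓜⁰_t - γ∫₀ᵗ p₀²` and the display
is `Δe₀ = -∫₀ᵗ j₀ + Q^L_t`. Proof: `y = z - (0, η)` is `C¹` with `y' = Y(z)`;
`e₀(z) = e₀(y) + A₀η₀ + η₀²/2`; the chain rule for `e₀ ∘ y` with the closed forms `∂_{q₀}H = U'(q₀) - V'(q₁-q₀)`,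
`j₀ = -½(p₀+p₁)V'(q₁-q₀)` (as in part 1) gives `(e₀∘y)' = -j₀(z) - γp₀² - η₀ A₀'`; integrate.

* `pinnedChain_siteEnergy_chainFlow_eq_aux` — the identity for a pair of sites `i0, i1` with values `0, 1`;
* `pinnedChain_siteEnergy_chainFlow_eq` — the identity with the literal indices `⟨0, _⟩, ⟨1, hN⟩` of the
  stub (registered sub-goal of `stub_bathBondReduction`).

Nothing here closes an item.
-/

noncomputable section

open MeasureTheory Filter Topology Set Finset
open Literature.MathematicalPhysics.KineticTheory.HeatConduction

namespace Summit.AtomisticToContinuum.FouriersLaw.Theorems.SubdiffusiveBondHeat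

open OscillatorChain

variable {N : ℕ}

section Aux

/-! Private copies of two closed forms from part 1 (`…BathBondReductionGenerator.lean`:
`dPotential_siteZero`, `bondCurrent_siteZero`), so that this file elaborates independently of it. -/

variable (P : OscillatorChain) {i0 i1 : Fin N}

/-- `∂_{q₀} H = ∂Φ/∂q₀ = U'(q₀) - V'(q₁ - q₀)` on a chain with `N ≥ 2` sites (closed form of
`OscillatorChain.dPotential` at the left end `i0 = 0`, `i1 = 1`: only the bond `(0,1)` touches site `0`).
[folklore] -/
private theorem dPotential_siteZero_aux (hi0 : i0.val = 0) (hi1 : i1.val = 1) (q : Fin N → ℝ) :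
    P.dPotential N i0 q = deriv P.U (q i0) - deriv P.V (q i1 - q i0) := by
  have h01 : i0 ≠ i1 := by
    intro h; have := congrArg Fin.val h; omega
  unfold OscillatorChain.dPotential
  -- only `k = i0` contributes to the outer sum
  rw [Fintype.sum_eq_single i0]
  · -- only `l = i1` contributes to the inner sum
    rw [Fintype.sum_eq_single i1]
    · have hc : i1.val = i0.val + 1 := by omega
      simp only [hc, if_true, h01.symm, if_false]
      ring
    · intro l hl
      have hl1 : ¬ (l.val = i0.val + 1) := by
        intro h; apply hl; exact Fin.ext (by omega)
      simp only [hl1, if_false]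
  · intro k hk
    refine Finset.sum_eq_zero fun l _ => ?_
    by_cases hlk : l.val = k.val + 1
    · have hl0 : l ≠ i0 := by
        intro h; have := congrArg Fin.val h; omega
      simp only [hlk, if_true, hl0, hk, if_false, sub_self, mul_zero]
    · simp only [hlk, if_false]

/-- The bond current through the bath bond `(0, 1)`: `j₀ = -½ (p₀ + p₁) V'(q₁ - q₀)` (closed form of
`OscillatorChain.bondCurrent N i0` when `i1 = i0 + 1` is a site). [folklore] -/
private theorem bondCurrent_siteZero_aux (hi : i1.val = i0.val + 1) (x : PhaseSpace N) :
    P.bondCurrent N i0 x = -((x.2 i0 + x.2 i1) / 2 * deriv P.V (x.1 i1 - x.1 i0)) := by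
  unfold OscillatorChain.bondCurrent
  rw [Fintype.sum_eq_single i1]
  · simp [hi]
  · intro j hj
    have hj1 : ¬ (j.val = i0.val + 1) := by
      intro h; apply hj; exact Fin.ext (by omega)
    simp only [hj1, if_false]

end Aux

/-- **The pathwise energy balance at the bath site** (pinned chain, `ω₂ > 0`, `lam, β, γ ≥ 0`; sites
`i0, i1` with values `0, 1`, so `N ≥ 2`): along the flow `z = chainFlow x η` driven by a continuous noise
path `η`, for `t ≥ 0`,
`e₀(z t) = e₀(x) - ∫₀ᵗ j₀(z s) ds - γ∫₀ᵗ p₀(s)² ds + (A₀(t)η₀(t) - ∫₀ᵗ η₀ A₀' + η₀(t)²/2)`,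
`A₀ = p₀ - η₀`, `A₀' = Y(z)_{p,0}`. [folklore] -/
theorem pinnedChain_siteEnergy_chainFlow_eq_aux {ω₂ lam β γ : ℝ} (hω : 0 < ω₂) (hl : 0 ≤ lam)
    (hβ : 0 ≤ β) (hγ : 0 ≤ γ) {i0 i1 : Fin N} (hi0 : i0.val = 0) (hi1 : i1.val = 1)
    (x : PhaseSpace N) {η : ℝ → Fin N → ℝ} (hη : Continuous η) {t : ℝ} (ht : 0 ≤ t) :
    ((pinnedChain ω₂ lam β γ).chainFlow N x η t).2 i0 ^ 2 / 2 +
        (pinnedChain ω₂ lam β γ).U (((pinnedChain ω₂ lam β γ).chainFlow N x η t).1 i0) +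
        (pinnedChain ω₂ lam β γ).V (((pinnedChain ω₂ lam β γ).chainFlow N x η t).1 i1 -
          ((pinnedChain ω₂ lam β γ).chainFlow N x η t).1 i0) / 2 =
      (x.2 i0 ^ 2 / 2 + (pinnedChain ω₂ lam β γ).U (x.1 i0) + (pinnedChain ω₂ lam β γ).V (x.1 i1 - x.1 i0) / 2) -
        (∫ s in (0 : ℝ)..t, (pinnedChain ω₂ lam β γ).bondCurrent N i0 ((pinnedChain ω₂ lam β γ).chainFlow N x η s)) -
        γ * (∫ s in (0 : ℝ)..t, ((pinnedChain ω₂ lam β γ).chainFlow N x η s).2 i0 ^ 2) +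
        ((((pinnedChain ω₂ lam β γ).chainFlow N x η t).2 i0 - η t i0) * η t i0 -
          (∫ s in (0 : ℝ)..t, η s i0 *
            ((pinnedChain ω₂ lam β γ).drift N ((pinnedChain ω₂ lam β γ).chainFlow N x η s)).2 i0) +
          η t i0 ^ 2 / 2) := by
  have h01 : i0 ≠ i1 := by
    intro h; have := congrArg Fin.val h; omega
  have hN : 1 < N := by have := i1.isLt; omega
  set P := pinnedChain ω₂ lam β γ with hP
  set Y := P.drift N with hYdef
  set z := P.chainFlow N x η with hzdef
  have hU : Differentiable ℝ P.U := (pinnedChain_contDiff_U ω₂ lam β γ (n := 1)).differentiable one_ne_zero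
  have hV : Differentiable ℝ P.V := (pinnedChain_contDiff_V ω₂ lam β γ (n := 1)).differentiable one_ne_zero
  have hUc : Continuous (deriv P.U) := (pinnedChain_contDiff_U ω₂ lam β γ (n := 1)).continuous_deriv le_rfl
  have hVc : Continuous (deriv P.V) := (pinnedChain_contDiff_V ω₂ lam β γ (n := 1)).continuous_deriv le_rfl
  have hYc : Continuous Y := (pinnedChain_contDiff_drift ω₂ lam β γ N (n := 0)).continuous
  have hzc : Continuous z := pinnedChain_continuous_chainFlow hω hl hβ hγ N x hη
  have hz_eq : ∀ s ∈ Icc 0 t, z s = forcing x η s + ∫ r in (0 : ℝ)..s, Y (z r) :=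
    pinnedChain_isIntegralSolutionOn_chainFlow hω hl hβ hγ N x hη t
  -- `y(t) = x + ∫₀ᵗ Y(z)`, `y' = Y(z)`, `y = z - (0, η)` on `[0, t]`
  set y : ℝ → PhaseSpace N := fun s => x + ∫ r in (0 : ℝ)..s, Y (z r) with hydef
  have hy_deriv : ∀ s, HasDerivAt y (Y (z s)) s := fun s => by
    have h1 : HasDerivAt (fun u => ∫ r in (0 : ℝ)..u, Y (z r)) (Y (z s)) s :=
      ((hYc.comp hzc).integral_hasStrictDerivAt 0 s).hasDerivAt
    exact h1.const_add x
  have hyc : Continuous y := continuous_iff_continuousAt.2 fun s => (hy_deriv s).continuousAt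
  have hy_eq : ∀ s ∈ Icc 0 t, y s = z s - ((0 : Fin N → ℝ), η s) := fun s hs => by
    rw [hz_eq s hs]
    simp only [hydef, forcing]
    abel
  have hy1 : ∀ s ∈ Icc 0 t, (y s).1 = (z s).1 := fun s hs => by
    rw [hy_eq s hs]; simp
  have hy2 : ∀ s ∈ Icc 0 t, ∀ i, (y s).2 i = (z s).2 i - η s i := fun s hs i => by
    rw [hy_eq s hs]; simp
  have hy0 : y 0 = x := by simp [hydef]
  -- derivatives of the three coordinates of `y` entering `e₀`
  have hfst : ∀ s, HasDerivAt (fun s => (y s).1) ((Y (z s)).1) s := fun s =>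
    (ContinuousLinearMap.fst ℝ (Fin N → ℝ) (Fin N → ℝ)).hasFDerivAt.comp_hasDerivAt s (hy_deriv s)
  have hsnd : ∀ s, HasDerivAt (fun s => (y s).2) ((Y (z s)).2) s := fun s =>
    (ContinuousLinearMap.snd ℝ (Fin N → ℝ) (Fin N → ℝ)).hasFDerivAt.comp_hasDerivAt s (hy_deriv s)
  have ha : ∀ s, HasDerivAt (fun s => (y s).2 i0) ((Y (z s)).2 i0) s := fun s => hasDerivAt_pi.1 (hsnd s) i0
  have hb : ∀ s, HasDerivAt (fun s => (y s).1 i0) ((Y (z s)).1 i0) s := fun s => hasDerivAt_pi.1 (hfst s) i0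
  have hc : ∀ s, HasDerivAt (fun s => (y s).1 i1) ((Y (z s)).1 i1) s := fun s => hasDerivAt_pi.1 (hfst s) i1
  -- the derivative of `e₀ ∘ y`
  set φ' : ℝ → ℝ := fun s => (y s).2 i0 * (Y (z s)).2 i0 + deriv P.U ((y s).1 i0) * (Y (z s)).1 i0 +
    deriv P.V ((y s).1 i1 - (y s).1 i0) * ((Y (z s)).1 i1 - (Y (z s)).1 i0) / 2 with hφ'
  have hφ : ∀ s, HasDerivAt (fun s => (y s).2 i0 ^ 2 / 2 + P.U ((y s).1 i0) + P.V ((y s).1 i1 - (y s).1 i0) / 2)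
      (φ' s) s := by
    intro s
    have h1 := ((ha s).pow 2).div_const 2
    have h2 : HasDerivAt (fun s => P.U ((y s).1 i0)) (deriv P.U ((y s).1 i0) * (Y (z s)).1 i0) s :=
      (hU _).hasDerivAt.comp s (hb s)
    have h3 : HasDerivAt (fun s => P.V ((y s).1 i1 - (y s).1 i0) / 2)
        (deriv P.V ((y s).1 i1 - (y s).1 i0) * ((Y (z s)).1 i1 - (Y (z s)).1 i0) / 2) s :=
      ((hV _).hasDerivAt.comp s ((hc s).sub (hb s))).div_const 2
    refine ((h1.add h2).add h3).congr_deriv ?_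
    simp only [hφ']
    push_cast
    ring
  have hφ'c : Continuous φ' := by
    have hy1c : Continuous fun s => (y s).1 := continuous_fst.comp hyc
    have hy2c : Continuous fun s => (y s).2 := continuous_snd.comp hyc
    have hY1c : Continuous fun s => (Y (z s)).1 := continuous_fst.comp (hYc.comp hzc)
    have hY2c : Continuous fun s => (Y (z s)).2 := continuous_snd.comp (hYc.comp hzc)
    have h_a : Continuous fun s => (y s).2 i0 := (continuous_apply i0).comp hy2c
    have h_b : Continuous fun s => (y s).1 i0 := (continuous_apply i0).comp hy1c
    have h_c : Continuous fun s => (y s).1 i1 := (continuous_apply i1).comp hy1c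
    have h_a' : Continuous fun s => (Y (z s)).2 i0 := (continuous_apply i0).comp hY2c
    have h_b' : Continuous fun s => (Y (z s)).1 i0 := (continuous_apply i0).comp hY1c
    have h_c' : Continuous fun s => (Y (z s)).1 i1 := (continuous_apply i1).comp hY1c
    simp only [hφ']
    exact ((h_a.mul h_a').add ((hUc.comp h_b).mul h_b')).add
      (((hVc.comp (h_c.sub h_b)).mul (h_c'.sub h_b')).div_const 2)
  have hFTC : ∫ s in (0 : ℝ)..t, φ' s =
      ((y t).2 i0 ^ 2 / 2 + P.U ((y t).1 i0) + P.V ((y t).1 i1 - (y t).1 i0) / 2) -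
        (x.2 i0 ^ 2 / 2 + P.U (x.1 i0) + P.V (x.1 i1 - x.1 i0) / 2) := by
    rw [intervalIntegral.integral_eq_sub_of_hasDerivAt (fun s _ => hφ s) (hφ'c.intervalIntegrable _ _), hy0]
  -- the integrand on `[0, t]`: `(e₀ ∘ y)' = -j₀(z) - γ p₀² - η₀ Y(z)_{p,0}`
  have hbw : bathWeight N i0 = 1 := by
    unfold bathWeight
    have h1 : ¬ (i0.val = N - 1) := by omega
    rw [if_pos hi0, if_neg h1]; ring
  have hintegrand : ∀ s ∈ uIcc 0 t, φ' s =
      -P.bondCurrent N i0 (z s) - γ * (z s).2 i0 ^ 2 - η s i0 * (Y (z s)).2 i0 := by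
    intro s hs
    rw [uIcc_of_le ht] at hs
    have hY1 : ∀ i, (Y (z s)).1 i = (z s).2 i := fun i => rfl
    have hY2 : (Y (z s)).2 i0 = -(deriv P.U ((z s).1 i0) - deriv P.V ((z s).1 i1 - (z s).1 i0)) - γ * (z s).2 i0 := by
      show -partialQ i0 (P.hamiltonian N) (z s) - P.γ * bathWeight N i0 * (z s).2 i0 = _
      rw [P.partialQ_hamiltonian_eq_dPotential hU hV, dPotential_siteZero_aux P hi0 hi1, hbw]
      simp [hP, pinnedChain]
    simp only [hφ', hy1 s hs, hy2 s hs, hY1, bondCurrent_siteZero_aux P (i0 := i0) (i1 := i1) (by omega) (z s)]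
    rw [hY2]
    ring
  have hIj : IntervalIntegrable (fun s => P.bondCurrent N i0 (z s)) volume 0 t :=
    ((pinnedChain_continuous_bondCurrent ω₂ lam β γ N i0).comp hzc).intervalIntegrable _ _
  have hIp : IntervalIntegrable (fun s => (z s).2 i0 ^ 2) volume 0 t :=
    (((continuous_apply i0).comp (continuous_snd.comp hzc)).pow 2).intervalIntegrable _ _
  have hIη : IntervalIntegrable (fun s => η s i0 * (Y (z s)).2 i0) volume 0 t :=
    (((continuous_apply i0).comp hη).mul
      ((continuous_apply i0).comp (continuous_snd.comp (hYc.comp hzc)))).intervalIntegrable _ _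
  have hsplit : ∫ s in (0 : ℝ)..t, φ' s =
      -(∫ s in (0 : ℝ)..t, P.bondCurrent N i0 (z s)) - γ * (∫ s in (0 : ℝ)..t, (z s).2 i0 ^ 2) -
        ∫ s in (0 : ℝ)..t, η s i0 * (Y (z s)).2 i0 := by
    have hI2 : IntervalIntegrable (fun s => -P.bondCurrent N i0 (z s)) volume 0 t := hIj.neg
    have hI3 : IntervalIntegrable (fun s => γ * (z s).2 i0 ^ 2) volume 0 t := hIp.const_mul γ
    have hI1 : IntervalIntegrable (fun s => -P.bondCurrent N i0 (z s) - γ * (z s).2 i0 ^ 2) volume 0 t :=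
      hI2.sub hI3
    rw [intervalIntegral.integral_congr hintegrand, intervalIntegral.integral_sub hI1 hIη,
      intervalIntegral.integral_sub hI2 hI3, intervalIntegral.integral_neg, intervalIntegral.integral_const_mul]
  -- `e₀(z t) = e₀(y t) + A₀ η₀ + η₀²/2`
  have hzt2 : (z t).2 i0 = (y t).2 i0 + η t i0 := by
    rw [hy2 t ⟨ht, le_rfl⟩ i0]; ring
  have hzt1 : (z t).1 = (y t).1 := (hy1 t ⟨ht, le_rfl⟩).symm
  have hA : (y t).2 i0 = (z t).2 i0 - η t i0 := hy2 t ⟨ht, le_rfl⟩ i0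
  rw [hzt1, hzt2]
  rw [hA] at hFTC ⊢
  linarith [hFTC, hsplit]

/-- **The pathwise energy balance at the bath site, `∫₀ᵗ j₀ = Q^L_t - Δe₀` path by path** (pinned
chain, `ω₂ > 0`, `lam, β, γ ≥ 0`, `N ≥ 2`; registered sub-goal of `stub_bathBondReduction`): along the
flow `z = chainFlow x η` of `LangevinChainSDE.lean` driven by a continuous momentum-noise path `η`, for
`t ≥ 0`, the bath-site energy `e₀ = p₀²/2 + U(q₀) + ½V(q₁ - q₀)` satisfies
`e₀(z t) = e₀(x) - ∫₀ᵗ j₀(z s) ds - γ ∫₀ᵗ p₀(s)² ds + 𝓜⁰_t` with the site-`0` noise work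
`𝓜⁰_t = (p₀(t) - η₀(t)) η₀(t) - ∫₀ᵗ η₀(s) Y(z(s))_{p,0} ds + η₀(t)²/2` (the `i = 0` summand of
`OscillatorChain.noiseWork`; for `η₀ = √(2γT_L) B` it is `√(2γT_L)∫₀ᵗ p₀ dB + γT_L t`, so that
`Q^L_t = 𝓜⁰_t - γ∫₀ᵗ p₀²` is the left-bath heat). [folklore] -/
theorem pinnedChain_siteEnergy_chainFlow_eq :
    ∀ (ω₂ lam β γ : ℝ), 0 < ω₂ → 0 ≤ lam → 0 ≤ β → 0 ≤ γ → ∀ (N : ℕ) (hN : 1 < N) (x : PhaseSpace N)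
      (η : ℝ → Fin N → ℝ), Continuous η → ∀ t : ℝ, 0 ≤ t →
      ((pinnedChain ω₂ lam β γ).chainFlow N x η t).2 ⟨0, Nat.zero_lt_of_lt hN⟩ ^ 2 / 2 +
          (pinnedChain ω₂ lam β γ).U (((pinnedChain ω₂ lam β γ).chainFlow N x η t).1 ⟨0, Nat.zero_lt_of_lt hN⟩) +
          (pinnedChain ω₂ lam β γ).V (((pinnedChain ω₂ lam β γ).chainFlow N x η t).1 ⟨1, hN⟩ -
            ((pinnedChain ω₂ lam β γ).chainFlow N x η t).1 ⟨0, Nat.zero_lt_of_lt hN⟩) / 2 =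
        (x.2 ⟨0, Nat.zero_lt_of_lt hN⟩ ^ 2 / 2 + (pinnedChain ω₂ lam β γ).U (x.1 ⟨0, Nat.zero_lt_of_lt hN⟩) +
            (pinnedChain ω₂ lam β γ).V (x.1 ⟨1, hN⟩ - x.1 ⟨0, Nat.zero_lt_of_lt hN⟩) / 2) -
          (∫ s in (0 : ℝ)..t, (pinnedChain ω₂ lam β γ).bondCurrent N ⟨0, Nat.zero_lt_of_lt hN⟩
            ((pinnedChain ω₂ lam β γ).chainFlow N x η s)) -
          γ * (∫ s in (0 : ℝ)..t, ((pinnedChain ω₂ lam β γ).chainFlow N x η s).2 ⟨0, Nat.zero_lt_of_lt hN⟩ ^ 2) +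
          ((((pinnedChain ω₂ lam β γ).chainFlow N x η t).2 ⟨0, Nat.zero_lt_of_lt hN⟩ - η t ⟨0, Nat.zero_lt_of_lt hN⟩) *
              η t ⟨0, Nat.zero_lt_of_lt hN⟩ -
            (∫ s in (0 : ℝ)..t, η s ⟨0, Nat.zero_lt_of_lt hN⟩ *
              ((pinnedChain ω₂ lam β γ).drift N ((pinnedChain ω₂ lam β γ).chainFlow N x η s)).2
                ⟨0, Nat.zero_lt_of_lt hN⟩) +
            η t ⟨0, Nat.zero_lt_of_lt hN⟩ ^ 2 / 2) := by
  intro ω₂ lam β γ hω hl hβ hγ N hN x η hη t ht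
  exact pinnedChain_siteEnergy_chainFlow_eq_aux hω hl hβ hγ (i0 := ⟨0, Nat.zero_lt_of_lt hN⟩) (i1 := ⟨1, hN⟩)
    rfl rfl x hη ht

end Summit.AtomisticToContinuum.FouriersLaw.Theorems.SubdiffusiveBondHeat
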